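import Literature.Analysis.FluidPDE.AnomalousDissipationProofs
import Summits.AnomalousDissipation.AnomalousDissipation.Theorems.SoloInformedWitnessConstraints
import HarnessLib

/-!
# Free viscous decay: the finite-window anomaly with viscosity-dependent data is trivial
(solo-informed; statement design of `AnomalousDissipation`)

The registered summit `AnomalousDissipation := Literature.Turb.ZerothLaw` is a LONG-TIME statement
(`limsup` of Cesàro means from `t = 0`) in which the initial data `u₀ j` may depend on `j`, i.e.
on the viscosity.  Its two FINITE-WINDOW neighbours behave in opposite ways, and this file puts
the cheap half of that contrast into the kernel.

* Datum PINNED (`u m 0 = u₀` for one smooth `u₀`, one smooth steady force): anomalous dissipation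
  on `[0,1]` is `Literature.Analysis.FluidPDE.BrueDeLellisQuestion22` — open, and any proof of it
  exhibits finite-time blow-up of smooth forced Euler on `T³`
  (`Literature.Barriers.AnomalousDissipation.BrueDeLellis2023_noAnomaly_beforeEulerSingularityNarrow`,
  `.not_question22`).
* Datum FREE (depending on the viscosity, of bounded — here constant — energy): the same window
  statement is TRIVIALLY TRUE, with NO force at all (`freeDecay_window_anomaly` below).  Free
  viscous decay of the circularly polarised shear mode `P_N = (sin 2πN x₁, 0, cos 2πN x₁)` at
  frequency `N = m + 1` and viscosity `ν_m = 1/(m+1)`,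
  `u_m(t) = e^{-r_m t} P_{m+1}`, `r_m = ν_m · 4π²(m+1)² = 4π²(m+1)`, `p_m = 0`,
  is a classical (Navier–)Stokes solution with zero force whose energy never exceeds `‖P‖₂² ≤ 2`
  and which dissipates `ν_m ∫₀¹ ‖∇u_m‖₂² = (1 - e^{-2 r_m})/2 ≥ 12/25` on `[0, 1]`, for every `m`.

So "anomalous dissipation on a window from `ν`-dependent smooth data of bounded energy" is
nothing but the viscous decay of a planted small scale.  This is why every finite-window
formulation in print pins the data (Bruè–De Lellis 2023, Questions 2.1–2.4: one datum `u₀`;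
Bruè–Colombo–Crippa–De Lellis–Sorella 2024, Theorem 1: datum `0`; Johansson–Sorella 2024: data
converging in `C^α`), and why the long-time summit need not: there a datum is dissipated once and
contributes nothing to `limsup` Cesàro means (`meanDissipation ≤ ‖f‖₂ · meanEnergy^{1/2}`,
`SoloInformedWitnessConstraints`; with `f = 0` the mean dissipation of ANY global Leray–Hopf
family is `0`).  The example is the datum-driven twin of the force-driven pulsed Stokes shear flow
of BCCDS 2024, §1 Remark 2 (zero datum, `ν`-dependent force of fixed `L¹_t L^∞_x` mass), vendored in
`Literature.Analysis.FluidPDE.AnomalousDissipationProofs` (namespace `PulsedShear`, discharge of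
`bccds_onsager_critical`), whose profile `P_N`, viscosities `ν_m`, rates `r_m` and envelope
`E_m(t) = e^{-r_m t}` are reused verbatim: there `u_m = (E_m - E_m²) P_{m+1}` is driven from rest by
the force `r_m E_m² P_{m+1}`; here `u_m = E_m P_{m+1}` starts from `P_{m+1}` and is driven by nothing.

## References

* E. Bruè, C. De Lellis, *Anomalous dissipation for the forced 3D Navier–Stokes equations*,
  Comm. Math. Phys. 400 (2023) 1507–1533, §1–2, Questions 2.1–2.4. [`BrueDeLellisCMP2023`]
* E. Bruè, M. Colombo, G. Crippa, C. De Lellis, M. Sorella, *Onsager critical solutions of the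
  forced Navier–Stokes equations*, arXiv:2212.08413 = Comm. Pure Appl. Anal. 23 (2024), §1,
  Theorem 1 and Remark 2. [`BCCDS2024`]
-/

open MeasureTheory Set Filter Topology UnitAddTorus
open scoped NNReal ENNReal InnerProductSpace ContDiff

noncomputable section

namespace Summit.AnomalousDissipation.AnomalousDissipation.Theorems

namespace FreeDecay

open Literature.Analysis.FluidPDE Literature.Analysis.FluidPDE.PulsedShear
  Literature.Analysis.FunctionSpaces Literature.Analysis.FunctionSpaces.Torus

/-! ## The family -/

/-- The freely decaying shear modes `u_m (t) = E_m (t) P_{m+1} = e^{-4π²(m+1) t} P_{m+1}`.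
[folklore] -/
def decay (m : ℕ) (t : ℝ) : T3 → R3 := E m t • profile (m + 1)

/-- The (viscosity-dependent) initial data `u_m (0) = P_{m+1}`. [folklore] -/
def seed (m : ℕ) : T3 → R3 := profile (m + 1)

/-- Unfolding `decay`. [folklore] -/
@[simp] theorem decay_apply (m : ℕ) (t : ℝ) (x : T3) :
    decay m t x = E m t • profile (m + 1) x := rfl

/-- `u_m (0) = P_{m+1}`. [folklore] -/
theorem decay_zero (m : ℕ) : decay m 0 = seed m := by
  funext x
  simp [seed, E_zero]

/-- The data are smooth. [folklore] -/
theorem isSmooth_seed (m : ℕ) : IsSmooth (seed m) := isSmooth_profile _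

/-- The data are divergence free. [folklore] -/
theorem isDivFree_seed (m : ℕ) : IsDivFree (seed m) := isDivFree_profile _

/-! ## The (unforced) Navier–Stokes equations on `[0, 1] × T³` -/

/-- `u_m` is jointly smooth. [folklore] -/
theorem isSmoothSpaceTimeOn_decay (m : ℕ) (S : Set ℝ) : IsSmoothSpaceTimeOn S (decay m) :=
  (contDiff_stLift_smul_profile (contDiff_E m) (m + 1)).contDiffOn

/-- `∂ₜ u_m = -r_m E_m P` within `[0, 1]`. [folklore] -/
theorem timeDerivWithin_decay (m : ℕ) {t : ℝ} (ht : t ∈ Icc (0 : ℝ) 1) (x : T3) :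
    Torus.timeDerivWithin (Icc 0 1) (decay m) t x = (-rate m * E m t) • profile (m + 1) x := by
  have h : HasDerivWithinAt (fun τ => decay m τ x) ((-rate m * E m t) • profile (m + 1) x)
      (Icc 0 1) t :=
    ((hasDerivAt_E m t).smul_const (profile (m + 1) x)).hasDerivWithinAt
  exact h.derivWithin (uniqueDiffOn_Icc zero_lt_one t ht)

/-- Shear flows have no self-advection: `(u_m · ∇) u_m = 0`. [folklore] -/
theorem convect_decay (m : ℕ) (t : ℝ) (x : T3) : Torus.convect (decay m t) (decay m t) x = 0 := by
  have h1 : IsContDiff 1 (decay m t) := (isContDiff_profile (m + 1)).smul (E m t)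
  unfold Torus.convect
  rw [fderiv_apply_eq_sum_partialDeriv h1]
  refine Finset.sum_eq_zero fun i _ => ?_
  rw [decay, partialDeriv_const_smul (isContDiff_profile _) (E m t) i]
  by_cases hi : i = 1
  · subst hi
    simp [profile_apply_one]
  · rw [Pi.smul_apply (E m t) (partialDeriv i (profile _)), partialDeriv_profile_of_ne_one _ hi,
      smul_zero, smul_zero]

/-- `Δ u_m = -4π² (m+1)² u_m`. [folklore] -/
theorem laplacian_decay (m : ℕ) (t : ℝ) (x : T3) :
    laplacian (decay m t) x =
      (-(4 * Real.pi ^ 2 * ((m + 1 : ℕ) : ℝ) ^ 2) * E m t) • profile (m + 1) x := by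
  rw [decay, laplacian_const_smul_profile, laplacian_profile, smul_smul, mul_comm]

/-- `div u_m (t) = E_m (t) div P = 0`. [folklore] -/
theorem isDivFree_decay (m : ℕ) (t : ℝ) : IsDivFree (decay m t) := by
  intro x
  have hP := isDivFree_profile (m + 1) x
  unfold divergence at hP ⊢
  rw [← mul_zero (E m t), ← hP, Finset.mul_sum]
  refine Finset.sum_congr rfl fun i _ => ?_
  have hPi : IsContDiff 1 (fun y => profile (m + 1) y i) :=
    (EuclideanSpace.proj i : R3 →L[ℝ] ℝ).contDiff.comp (isContDiff_profile (m + 1))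
  have h : (fun y => (decay m t) y i) = E m t • fun y => profile (m + 1) y i := by
    funext y
    simp
  rw [h, partialDeriv_const_smul hPi, Pi.smul_apply, smul_eq_mul]

/-- The unforced momentum equation `∂ₜu + (u·∇)u = ν Δu - ∇p + 0` on `[0, 1] × T³`:
`-r_m E_m = ν_m · (-4π²(m+1)²) · E_m`. [folklore] -/
theorem momentum_decay (m : ℕ) {t : ℝ} (ht : t ∈ Icc (0 : ℝ) 1) (x : T3) :
    Torus.timeDerivWithin (Icc 0 1) (decay m) t x + Torus.convect (decay m t) (decay m t) x =
      nu m • laplacian (decay m t) x - Torus.gradient (pres m t) x + 0 := by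
  rw [timeDerivWithin_decay m ht, convect_decay, laplacian_decay, gradient_pres]
  simp only [add_zero, sub_zero]
  rw [smul_smul]
  congr 1
  linear_combination (E m t) * nu_mul_eq_rate m

/-- `(u_m, 0)` is a classical solution of the UNFORCED Navier–Stokes equations with viscosity
`ν_m = 1/(m+1)` on `[0, 1] × T³`. [folklore] -/
theorem isClassicalNSSolutionOn_decay (m : ℕ) :
    IsClassicalNSSolutionOn (Icc 0 1) (nu m) (fun _ _ => 0) (decay m) (pres m) where
  smooth_velocity := isSmoothSpaceTimeOn_decay m _
  smooth_pressure := isSmoothSpaceTimeOn_pres m _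
  momentum := fun _ ht x => momentum_decay m ht x
  divFree := fun t _ => isDivFree_decay m t

/-! ## Energy and dissipation -/

/-- `‖u_m (t, x)‖ ≤ ‖z‖ = √2` for `t ≥ 0`. [folklore] -/
theorem norm_decay_le (m : ℕ) {t : ℝ} (ht : 0 ≤ t) (x : T3) : ‖decay m t x‖ ≤ ‖pol‖ := by
  rw [decay_apply, norm_smul, Real.norm_eq_abs, abs_of_pos (E_pos m t)]
  calc E m t * ‖profile (m + 1) x‖ ≤ 1 * ‖pol‖ :=
        mul_le_mul (E_le_one m ht) (norm_profile_le _ _) (norm_nonneg _) zero_le_one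
    _ = ‖pol‖ := one_mul _

/-- **Bounded energy, uniformly in `m` and `t ≥ 0`**: `∫ ‖u_m (t)‖² ≤ 2`. [folklore] -/
theorem integral_norm_sq_decay_le (m : ℕ) {t : ℝ} (ht : 0 ≤ t) :
    ∫ x, ‖decay m t x‖ ^ 2 ≤ 2 := by
  have hc : Continuous (decay m t) :=
    ((isSmooth_profile (m + 1)).continuous).const_smul (E m t)
  calc ∫ x, ‖decay m t x‖ ^ 2 ≤ ∫ _ : T3, ‖pol‖ ^ 2 :=
        integral_mono (hc.norm.pow 2).integrable_unitAddTorus (integrable_const _)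
          fun x => pow_le_pow_left₀ (norm_nonneg _) (norm_decay_le m ht x) 2
    _ = 2 := by simp [norm_pol_sq]

/-- `∫ ‖u_m (0)‖² ≤ 2`. [folklore] -/
theorem integral_norm_sq_seed_le (m : ℕ) : ∫ x, ‖seed m x‖ ^ 2 ≤ 2 := by
  rw [← decay_zero]
  exact integral_norm_sq_decay_le m le_rfl

/-- `‖∇u_m (t)‖₂² = (2π (m+1))² E_m(t)²` (the gradient has constant pointwise norm). [folklore] -/
theorem gradNormSq_decay (m : ℕ) (t : ℝ) :
    gradNormSq (decay m t) = (2 * Real.pi * ((m + 1 : ℕ) : ℝ)) ^ 2 * E m t ^ 2 := by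
  unfold gradNormSq
  have h : ∀ x, ∑ i, ‖partialDeriv i (decay m t) x‖ ^ 2 =
      (2 * Real.pi * ((m + 1 : ℕ) : ℝ)) ^ 2 * E m t ^ 2 := by
    intro x
    rw [decay]
    simp_rw [partialDeriv_const_smul (isContDiff_profile _) (E m t), Pi.smul_apply, norm_smul,
      mul_pow, ← Finset.mul_sum, sum_norm_sq_partialDeriv_profile, Real.norm_eq_abs, sq_abs]
    ring
  simp_rw [h]
  simp

/-- **The dissipation on `[0, 1]`**: `ν_m ∫₀¹ ‖∇u_m‖₂² = r_m ∫₀¹ E_m² = (1 - e^{-2 r_m}) / 2`.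
[folklore] -/
theorem cumulativeDissipation_decay (m : ℕ) :
    cumulativeDissipation (nu m) (decay m) 0 1 = (1 - E m 1 ^ 2) / 2 := by
  unfold cumulativeDissipation
  simp_rw [gradNormSq_decay]
  rw [intervalIntegral.integral_const_mul, ← mul_assoc, nu_mul_eq_rate',
    integral_E_pow m (k := 2) two_ne_zero]
  have hr := (rate_pos m).ne'
  push_cast
  field_simp

/-- `ν_m ∫₀¹ ‖∇u_m‖₂² ≥ 12/25` for every `m` (`e^{-r_m} ≤ 1/37`). [folklore] -/
theorem le_cumulativeDissipation_decay (m : ℕ) :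
    12 / 25 ≤ cumulativeDissipation (nu m) (decay m) 0 1 := by
  rw [cumulativeDissipation_decay]
  have h1 := E_one_le m
  have h0 := (E_pos m 1).le
  nlinarith

/-- **Anomalous dissipation on the window `[0, 1]`** for the unforced family. [folklore] -/
theorem hasAnomalousDissipation_decay : HasAnomalousDissipation nu decay :=
  ⟨12 / 25, by norm_num, Eventually.of_forall le_cumulativeDissipation_decay⟩

end FreeDecay

open Literature.Analysis.FluidPDE Literature.Analysis.FunctionSpaces
  Literature.Analysis.FunctionSpaces.Torus in
/-- **The finite-window anomaly with free data is trivial.**  There are viscosities `ν_m ↓ 0`,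
smooth divergence-free data `u₀^m` with `∫ ‖u₀^m‖² ≤ 2`, and classical solutions `u_m` of the
Navier–Stokes equations with viscosity `ν_m`, ZERO force and datum `u₀^m` on `[0, 1] × T³`, of
energy `≤ 2` at all times, with `ν_m ∫₀¹ ‖∇u_m‖₂² ≥ 12/25` for every `m`
(`HasAnomalousDissipation`).  Compare `BrueDeLellisQuestion22`, which differs exactly in pinning
`u m 0 = u₀` to ONE datum (and allowing one smooth steady force): that version is open and implies
Euler blow-up (`BrueDeLellis2023_noAnomaly_beforeEulerSingularityNarrow.not_question22`).
[cite: BCCDS2024, §1 Remark 2 (the force-driven twin)] -/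
theorem freeDecay_window_anomaly :
    ∃ (ν : ℕ → ℝ) (u₀ : ℕ → T3 → R3) (u : ℕ → ℝ → T3 → R3) (p : ℕ → ℝ → T3 → ℝ),
      IsVanishingViscosity ν ∧
      (∀ m, IsSmooth (u₀ m) ∧ IsDivFree (u₀ m) ∧ ∫ x, ‖u₀ m x‖ ^ 2 ≤ 2) ∧
      (∀ m, IsClassicalNSSolutionOn (Icc 0 1) (ν m) (fun _ _ => 0) (u m) (p m) ∧ u m 0 = u₀ m) ∧
      (∀ m t, 0 ≤ t → ∫ x, ‖u m t x‖ ^ 2 ≤ 2) ∧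
      HasAnomalousDissipation ν u :=
  ⟨PulsedShear.nu, FreeDecay.seed, FreeDecay.decay, PulsedShear.pres,
    PulsedShear.isVanishingViscosity_nu,
    fun m => ⟨FreeDecay.isSmooth_seed m, FreeDecay.isDivFree_seed m,
      FreeDecay.integral_norm_sq_seed_le m⟩,
    fun m => ⟨FreeDecay.isClassicalNSSolutionOn_decay m, FreeDecay.decay_zero m⟩,
    fun m _ ht => FreeDecay.integral_norm_sq_decay_le m ht,
    FreeDecay.hasAnomalousDissipation_decay⟩

open Literature.Analysis.FluidPDE Literature.Analysis.FunctionSpaces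
  Literature.Analysis.FunctionSpaces.Torus in
/-- **… whereas the long-time statement without force is trivially false, free data or not.**
A family of global Leray–Hopf solutions with ZERO force, arbitrary (viscosity-dependent) data and
bounded mean energy admits no uniform floor on the mean dissipation
`ν_j · limsup_T ⨍₀ᵀ ‖∇u_j‖₂²` — by `zerothLaw_witness_energy_floor` (`ε ≤ ‖f‖₂ √E`, here `‖f‖₂ = 0`).
Together with `freeDecay_window_anomaly`: "anomalous dissipation at bounded energy from free data"
is true on a window and false in the long-time mean already at `f = 0`; the registered summit
(`Literature.Turb.ZerothLaw`: long-time means, free data, ONE fixed force `f`) is the reading in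
which neither triviality occurs. [cite: CheskidovDoeringPetrov2006, eq. (17)] -/
theorem no_longTime_anomaly_without_force {ν : ℕ → ℝ} {u₀ : ℕ → T3 → R3}
    {u : ℕ → ℝ → T3 → R3} (hν : ∀ j, 0 < ν j)
    (hLH : ∀ j, Torus.IsGlobalLerayHopf (ν j) (fun _ => fun _ => (0 : R3)) (u₀ j) (u j))
    {E ε : ℝ} (hE : ∀ j, meanEnergy (u j) ≤ E) (hε : 0 < ε)
    (hεle : ∀ j, ε ≤ meanDissipation (ν j) (u j)) : False := by
  have h := (zerothLaw_witness_energy_floor (f := fun _ => (0 : R3)) (isSmooth_const _)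
    (by simp [Torus.HasZeroMean]) hν hLH hE hε hεle).1
  simp at h

end Summit.AnomalousDissipation.AnomalousDissipation.Theorems

end
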